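import Literature.NumberTheory.Sieve.Maynard2016Prop92MainDecomposition
import Literature.NumberTheory.Sieve.Maynard2016Prop92LocalPairSumTotal
import Literature.NumberTheory.Sieve.FGKMT2018YSquareSumBridge
import Literature.NumberTheory.Sieve.FGKMT2018Prop91MainTermL84
import Literature.NumberTheory.Sieve.Maynard2016DenseClustersMixedProfile
import HarnessLib

/-!
# Maynard 2016, Prop. 9.2 (𝒜 = ℤ): `Σ_{r ∈ 𝒟'_k, r_m = 1} (∫ G dt_m)²/φ_ω(r)` as a `(k−1)`-fold sum of Lemma 8.4

Source: J. Maynard, *Dense clusters of primes in subsets*, Compositio Math. 152 (2016) = arXiv:1405.2593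
[Maynard2016DenseClusters], proof of Proposition 9.2 pp. 21–23: the restricted support
`𝒟'_k = {d : μ²(d) = 1, (d_j, W'_j) = 1 ∀ j}`, `W'_j = ∏_{p ∣ W_j (a_j b_m − a_m b_j)} p` (9.8), and display (9.19):
«We evaluate this sum using Lemma 8.4» — the sum `Σ_{r ∈ 𝒟'_k, r_m = 1} (y^{(m)}_r)²/φ_ω(r)` is, after Lemma 9.3
(`y^{(m)}_r ≈ (log R) c_m ∫ F dt_m`), a `(k−1)`-fold sum of the shape (8.9) in the coordinates `j ≠ m`, with
moduli `W'_j` and `g = φ_ω`; K. Ford, B. Green, S. Konyagin, J. Maynard, T. Tao, *Long gaps between primes*,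
JAMS 31 (2018) [FordGreenKonyaginMaynardTao2018], Thm 6 pp. 21–22 (the case `𝒜 = ℤ`).

PROVED here (no named facts), for `k = n + 1` and the tree's box `dkBoxP L B R m` (FGKMT2018's `𝒟_k` with
`d_m = 1` and `(d_j, a_j b_m − a_m b_j) = 1`, `Maynard2016Prop92Decomposition`):
* `sum_dkBoxP_eq_sum_insertNth` — re-indexing `r = (s; s_m := 1)` by the `n` coordinates `j ≠ m`;
* `idxModM` — the moduli `W'_j = W_j · |a_j b_m − a_m b_j|` (`j ≠ m`, listed along `m.succAbove`);
  `insertNth_mem_dkBoxP_iff`: `(s; 1) ∈ 𝒟'` iff `μ²(∏ s_j) = 1 ∧ (s_j, W'_j) = 1 ∀ j`;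
  `rWeight_idxModM_eq`: the Lemma-8.4 weight for `A(p) = p − ω(p)` is `1_{𝒟'}/φ_ω`;
* `margInt_insertNth`, `margInt_F_insertNth` (`∫ F dt_m = H_ψ(Σ_j u_j) ∏_j g_k(u_j)`),
  `margInt_F₂_insertNth_le` (`0 ≤ ∫ F₂ dt_m ≤ (∫h_k + k ∫g_k) ∏_j mixG_k(u_j/2)`);
* **`sum_margInt_F_sq_eq_rFoldSum`**: `Σ_{r} (∫F dt_m)²(u(r))/φ_ω(r) = rFoldSum n W' (p − ω) (H_ψ²) (g_k²) R 0`
  (the left side of (9.19) without the factor `(log R · c_m)²`, as an instance of (8.9));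
* **`sum_margInt_F₂_sq_le_rFoldSum`**: the same sum with `F₂` is
  `≤ (∫h_k + k∫g_k)² · rFoldSum n W' (p − ω) 1 (mixG_k²) (R²) 0` (the `F₂`-sum of (9.16)/(9.20), upper bound);
* the free-index census of `W'` for Lemma 8.4's `n(p)`: `nW_idxModM_eq_zero` (`p ∣ WB`),
  `nW_idxModM_eq_card_admIdxM` (`p ≤ ⌊R⌋`, `p ∤ WB`: `n(p) = #admIdxM = ω(p) − [p ∤ a_m]`, the Euler factors
  `(1 + (ω(p)−1)/φ_ω(p))` resp. `(1 + ω(p)/φ_ω(p))` printed in (9.19)), `nW_idxModM_eq_of_lt`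
  (`p > ⌊R⌋`, `p ∤ WB`: `n(p) = #{j ≠ m : p ∤ a_j b_m − a_m b_j}`).

## References
* J. Maynard, *Dense clusters of primes in subsets*, Compositio Math. 152 (2016), Prop. 9.2 (9.8), (9.16),
  (9.19)–(9.21), Lemma 8.4 [Maynard2016DenseClusters].
* K. Ford, B. Green, S. Konyagin, J. Maynard, T. Tao, *Long gaps between primes*, JAMS 31 (2018), Thm 6
  [FordGreenKonyaginMaynardTao2018].
-/

noncomputable section

open Finset MeasureTheory
open scoped ArithmeticFunction.Moebius

namespace Literature.NumberTheory.Sieve.FGKMT2018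

variable {n : ℕ}

/-! ### Re-indexing `𝒟'_k ∩ {r_m = 1}` by the coordinates `j ≠ m` -/

/-- For `r` with `r_m = 1`: `(removeNth m r; r_m := 1) = r`. [cite: Maynard2016DenseClusters, proof of Prop. 9.2 p. 21 («r_m = 1»)] -/
theorem insertNth_one_removeNth_of_mem {L : Fin (n + 1) → ℤ × ℤ} {B : ℕ} {R : ℝ} {m : Fin (n + 1)}
    {r : Fin (n + 1) → ℕ} (hr : r ∈ dkBoxP L B R m) : Fin.insertNth m 1 (Fin.removeNth m r) = r :=
  Fin.insertNth_eq_iff.2 ⟨(mem_dkBoxP_iff.1 hr).2.1.symm, rfl⟩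

/-- **Re-indexing**: `Σ_{r ∈ 𝒟', r_m = 1} f(r) = Σ_{s ∈ [1,⌊R⌋]^n, (s; 1) ∈ 𝒟'} f(s; s_m := 1)`.
[cite: Maynard2016DenseClusters, proof of Prop. 9.2 (9.19) (a sum over the k − 1 coordinates i ≠ m)] -/
theorem sum_dkBoxP_eq_sum_insertNth (L : Fin (n + 1) → ℤ × ℤ) (B : ℕ) (R : ℝ) (m : Fin (n + 1))
    (f : (Fin (n + 1) → ℕ) → ℝ) :
    ∑ r ∈ dkBoxP L B R m, f r =
      ∑ s ∈ (Fintype.piFinset fun _ : Fin n => Finset.Icc 1 ⌊R⌋₊).filter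
          (fun s => Fin.insertNth m 1 s ∈ dkBoxP L B R m), f (Fin.insertNth m 1 s) := by
  classical
  refine Finset.sum_nbij' (fun r => Fin.removeNth m r) (fun s => Fin.insertNth m 1 s) ?_ ?_ ?_ ?_ ?_
  · intro r hr
    have hbox := Fintype.mem_piFinset.1 (dkBox_subset_piFinset L B R (mem_dkBoxP_iff.1 hr).1)
    refine Finset.mem_filter.2 ⟨Fintype.mem_piFinset.2 fun j => hbox _, ?_⟩
    rw [insertNth_one_removeNth_of_mem hr]; exact hr
  · intro s hs; exact (Finset.mem_filter.1 hs).2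
  · intro r hr; exact insertNth_one_removeNth_of_mem hr
  · intro s _; exact Fin.removeNth_insertNth (α := fun _ => ℕ) m 1 s
  · intro r hr; rw [insertNth_one_removeNth_of_mem hr]

/-- `∏ᵢ (s; s_m := 1)ᵢ = ∏ⱼ sⱼ`. [cite: Maynard2016DenseClusters, proof of Prop. 9.2 p. 21 («r = ∏_{i ≠ m} r_i»)] -/
theorem prod_insertNth_one (m : Fin (n + 1)) (s : Fin n → ℕ) : ∏ i, Fin.insertNth m 1 s i = ∏ j, s j := by
  rw [Fin.prod_univ_succAbove _ m]
  simp only [Fin.insertNth_apply_same, Fin.insertNth_apply_succAbove, one_mul]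

/-! ### The moduli `W'_j = W_j · |a_j b_m − a_m b_j|` -/

/-- The moduli of `𝒟'_k` in the coordinates `j ≠ m` (listed along `m.succAbove`):
`W'_j = W_j · |a_j b_m − a_m b_j|` (only its set of prime factors matters, cf. (9.8)).
[cite: Maynard2016DenseClusters, proof of Prop. 9.2 (9.8) p. 21] -/
def idxModM (L : Fin (n + 1) → ℤ × ℤ) (B : ℕ) (R : ℝ) (m : Fin (n + 1)) (j : Fin n) : ℕ :=
  idxMod L B R (m.succAbove j) * (crossDet L m (m.succAbove j)).natAbs

/-- **`𝒟'_k ∩ {r_m = 1}` via the moduli `W'_j`**: for `s` in the box `1 ≤ s_j ≤ ⌊R⌋` (`⌊R⌋ ≥ 1`),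
`(s; s_m := 1) ∈ 𝒟'` iff `μ²(∏ⱼ sⱼ) = 1` and `(s_j, W'_j) = 1` for all `j`.
[cite: Maynard2016DenseClusters, proof of Prop. 9.2 (9.8) p. 21; FordGreenKonyaginMaynardTao2018, (7.5) p. 21] -/
theorem insertNth_mem_dkBoxP_iff {L : Fin (n + 1) → ℤ × ℤ} {B : ℕ} {R : ℝ} {m : Fin (n + 1)}
    {s : Fin n → ℕ} (hR : 1 ≤ ⌊R⌋₊) (hs : s ∈ Fintype.piFinset fun _ : Fin n => Finset.Icc 1 ⌊R⌋₊) :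
    Fin.insertNth m 1 s ∈ dkBoxP L B R m ↔
      Squarefree (∏ j, s j) ∧ ∀ j, (s j).Coprime (idxModM L B R m j) := by
  have hs' := Fintype.mem_piFinset.1 hs
  have hbox : Fin.insertNth m 1 s ∈ Fintype.piFinset fun _ : Fin (n + 1) => Finset.Icc 1 ⌊R⌋₊ := by
    rw [Fintype.mem_piFinset, Fin.forall_iff_succAbove m]
    refine ⟨?_, fun j => ?_⟩
    · rw [Fin.insertNth_apply_same]; exact Finset.mem_Icc.2 ⟨le_rfl, hR⟩
    · rw [Fin.insertNth_apply_succAbove]; exact hs' j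
  rw [mem_dkBoxP_iff, mem_dkBox_iff_coprime_idxMod hbox, prod_insertNth_one, Fin.insertNth_apply_same,
    Fin.forall_iff_succAbove m, Fin.insertNth_apply_same]
  simp only [Fin.insertNth_apply_succAbove, Nat.coprime_one_left_iff, true_and, and_assoc]
  constructor
  · rintro ⟨hsq, hW, hΔ⟩
    refine ⟨hsq, fun j => Nat.Coprime.mul_right (hW j) ?_⟩
    have h := hΔ (m.succAbove j) (Fin.succAbove_ne m j)
    rwa [Fin.insertNth_apply_succAbove] at h
  · rintro ⟨hsq, hW'⟩
    refine ⟨hsq, fun j => Nat.Coprime.coprime_dvd_right (Dvd.intro _ rfl) (hW' j), fun i hi => ?_⟩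
    obtain ⟨j, rfl⟩ := Fin.exists_succAbove_eq hi
    rw [Fin.insertNth_apply_succAbove]
    exact Nat.Coprime.coprime_dvd_right (Dvd.intro_left _ rfl) (hW' j)

/-- **The Lemma-8.4 weight is `1_{𝒟'}/φ_ω`**: for `s` in the box and `A(p) = p − ω_𝓛(p)`,
`rWeight n W' A s = 1_{(s;1) ∈ 𝒟'}/φ_ω(∏ⱼ sⱼ)`.
[cite: Maynard2016DenseClusters, proof of Prop. 9.2 (9.19) («using Lemma 8.4», g = φ_ω)] -/
theorem rWeight_idxModM_eq {L : Fin (n + 1) → ℤ × ℤ} {B : ℕ} {R : ℝ} {m : Fin (n + 1)} {s : Fin n → ℕ}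
    (hR : 1 ≤ ⌊R⌋₊) (hs : s ∈ Fintype.piFinset fun _ : Fin n => Finset.Icc 1 ⌊R⌋₊) :
    MaynardDense.rWeight n (idxModM L B R m) (fun p => (p : ℝ) - omegaL L p) s =
      if Fin.insertNth m 1 s ∈ dkBoxP L B R m then (phiOmega L (∏ j, s j))⁻¹ else 0 := by
  classical
  unfold MaynardDense.rWeight phiOmega
  by_cases h : Fin.insertNth m 1 s ∈ dkBoxP L B R m
  · rw [if_pos ((insertNth_mem_dkBoxP_iff hR hs).1 h), if_pos h]
  · rw [if_neg (fun h' => h ((insertNth_mem_dkBoxP_iff hR hs).2 h')), if_neg h]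

/-- The weight is `≥ 0` for admissible `𝓛` (`p − ω(p) > 0`). [cite: Maynard2016DenseClusters, Lemma 8.4 (8.9) (g ≥ 0)] -/
theorem rWeight_idxModM_nonneg {L : Fin (n + 1) → ℤ × ℤ} (hadm : FormsAdmissible L) (B : ℕ) (R : ℝ)
    (m : Fin (n + 1)) (s : Fin n → ℕ) :
    0 ≤ MaynardDense.rWeight n (idxModM L B R m) (fun p => (p : ℝ) - omegaL L p) s :=
  MaynardDense.rWeight_nonneg _ (fun _ hp => sub_omegaL_pos hadm hp) s

/-! ### The fibre integrals `∫ G dt_m` at `u(r)`, `r = (s; 1)` -/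

/-- `(u(s;1); u_m := t) = (u(s); t at m)`: updating the `m`-th coordinate of `log rᵢ/log R` for `r = (s; s_m := 1)`.
[cite: Maynard2016DenseClusters, Lemma 9.3 («t_i = log r_i/log R for i ≠ m»)] -/
theorem update_logVec_insertNth (R : ℝ) (m : Fin (n + 1)) (s : Fin n → ℕ) (t : ℝ) :
    Function.update (logVec R (Fin.insertNth m 1 s)) m t =
      Fin.insertNth m t (fun j => MaynardDense.uOf R (s j)) := by
  symm
  refine Fin.insertNth_eq_iff.2 ⟨by rw [Function.update_self], ?_⟩
  rw [Fin.removeNth_update]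
  funext j
  simp only [Fin.removeNth, logVec, Fin.insertNth_apply_succAbove, MaynardDense.uOf]

/-- `∫₀^∞ G(u(r); u_m := t) dt = ∫₀^∞ G(u(s); t at m) dt` for `r = (s; 1)`.
[cite: Maynard2016DenseClusters, Lemma 9.3 (∫ H dt_m), Prop. 9.2 (9.19)] -/
theorem margInt_insertNth (m : Fin (n + 1)) (G : (Fin (n + 1) → ℝ) → ℝ) (R : ℝ) (s : Fin n → ℕ) :
    margInt m G (logVec R (Fin.insertNth m 1 s)) =
      ∫ t in Set.Ici (0 : ℝ), G (Fin.insertNth m t (fun j => MaynardDense.uOf R (s j))) := by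
  unfold margInt
  exact setIntegral_congr_fun measurableSet_Ici fun t _ => by rw [update_logVec_insertNth]

/-- **`∫₀^∞ F dt_m = H_ψ(Σ_{j≠m} u_j) ∏_{j≠m} g_k(u_j)`** at `r = (s; 1)` (`k = n + 1`).
[cite: Maynard2016DenseClusters, Prop. 9.2 (9.19)–(9.21) (J_k(F) from ∫F dt_m), Lemma 9.3] -/
theorem margInt_F_insertNth (m : Fin (n + 1)) (R : ℝ) (s : Fin n → ℕ) :
    margInt m (MaynardDense.F (n + 1)) (logVec R (Fin.insertNth m 1 s)) =
      MaynardDense.Hpsi (n + 1) (∑ j, MaynardDense.uOf R (s j)) *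
        ∏ j, MaynardDense.prof (n + 1) (MaynardDense.uOf R (s j)) := by
  rw [margInt_insertNth, MaynardDense.inner_F_eq_Hpsi]

/-- `u_j = log s_j/log R ≥ 0` for `s_j ≥ 1`, `R > 1`. [cite: Maynard2016DenseClusters, Lemma 8.4 (u_i = log e_i/log R)] -/
theorem uOf_nonneg {R : ℝ} (hR : 1 < R) {e : ℕ} (he : 1 ≤ e) : 0 ≤ MaynardDense.uOf R e :=
  div_nonneg (Real.log_nonneg (by exact_mod_cast he)) (Real.log_pos hR).le

/-- `sumH k n t ≤ k ∏ᵢ (g_k(tᵢ) + h_k(tᵢ)/k)` on the orthant (the `n`-variable form of `F₂ ≤ k ∏ (g + h/k)`).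
[cite: Maynard2016DenseClusters, (7.6), proof of Prop. 9.2 (9.20) (bounding the F₂-integral by products)] -/
theorem sumH_le_mul_prod_mix {k : ℕ} (hk : 2 ≤ k) {t : Fin n → ℝ} (ht : t ∈ MaynardDense.orthant n) :
    MaynardDense.sumH k n t ≤ (k : ℝ) * ∏ i, (MaynardDense.prof k (t i) + MaynardDense.prof₂ k (t i) / k) := by
  classical
  rw [MaynardDense.mem_orthant] at ht
  have hk0 : (0 : ℝ) < k := by exact_mod_cast lt_of_lt_of_le (by norm_num) hk
  have h := MaynardDense.sum_mul_prod_erase_le_prod_add (Finset.univ : Finset (Fin n))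
    (a := fun i => MaynardDense.prof k (t i)) (b := fun i => MaynardDense.prof₂ k (t i) / k)
    (fun i _ => MaynardDense.prof_nonneg hk (ht i))
    (fun i _ => div_nonneg (MaynardDense.prof₂_nonneg hk (ht i)) hk0.le)
  have hS : MaynardDense.sumH k n t =
      (k : ℝ) * ∑ j, MaynardDense.prof₂ k (t j) / k * ∏ i ∈ univ.erase j, MaynardDense.prof k (t i) := by
    unfold MaynardDense.sumH
    rw [Finset.mul_sum]
    refine Finset.sum_congr rfl fun j _ => ?_
    rw [← Finset.mul_prod_erase univ (fun i => MaynardDense.profIte k j i (t i)) (Finset.mem_univ j)]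
    dsimp only [MaynardDense.profIte]
    rw [if_pos rfl]
    have : ∏ i ∈ univ.erase j, (if i = j then MaynardDense.prof₂ k (t i) else MaynardDense.prof k (t i)) =
        ∏ i ∈ univ.erase j, MaynardDense.prof k (t i) :=
      Finset.prod_congr rfl fun i hi => by rw [if_neg (Finset.ne_of_mem_erase hi)]
    rw [this]
    field_simp
  rw [hS]
  exact mul_le_mul_of_nonneg_left h hk0.le

/-- **`0 ≤ ∫₀^∞ F₂ dt_m ≤ (∫h_k + k∫g_k) · ∏_{j≠m} mixG_k(u_j/2)`** at `r = (s; 1)` (`k = n + 1`, `s_j ≥ 1`, `R > 1`):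
`∫ F₂ dt_m = (∫h)∏g(u_j) + (∫g)·sumH ≤ (∫h + k∫g) ∏ (g + h/k)(u_j)` and `(g + h/k)(u) = mixG(u/2)`.
[cite: Maynard2016DenseClusters, proof of Prop. 9.2 (9.20) (the F₂² integral ≪ products of one-variable integrals), (7.6)] -/
theorem margInt_F₂_insertNth_le (hn : 2 ≤ n + 1) (m : Fin (n + 1)) {R : ℝ} (hR : 1 < R) {s : Fin n → ℕ}
    (hs : ∀ j, 1 ≤ s j) :
    0 ≤ margInt m (MaynardDense.F₂ (n + 1)) (logVec R (Fin.insertNth m 1 s)) ∧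
      margInt m (MaynardDense.F₂ (n + 1)) (logVec R (Fin.insertNth m 1 s)) ≤
        (MaynardDense.ell₂ (n + 1) + (n + 1 : ℕ) * MaynardDense.ell (n + 1)) *
          ∏ j, MaynardDense.mixG (n + 1) (MaynardDense.uOf R (s j) / 2) := by
  set u : Fin n → ℝ := fun j => MaynardDense.uOf R (s j) with hu
  have hu0 : u ∈ MaynardDense.orthant n := MaynardDense.mem_orthant.2 fun j => uOf_nonneg hR (hs j)
  have hu0' : ∀ j, 0 ≤ u j := fun j => uOf_nonneg hR (hs j)
  rw [margInt_insertNth, MaynardDense.inner_F₂_eq hn m u]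
  have hk0 : (0 : ℝ) < (n + 1 : ℕ) := by positivity
  have hℓ₂ := MaynardDense.ell₂_nonneg hn
  have hℓ := (MaynardDense.ell_pos hn).le
  have hP0 : 0 ≤ ∏ j, MaynardDense.prof (n + 1) (u j) :=
    Finset.prod_nonneg fun j _ => MaynardDense.prof_nonneg hn (hu0' j)
  have hH0 := MaynardDense.sumH_nonneg hn hu0 (k := n + 1)
  refine ⟨by positivity, ?_⟩
  have hmix : ∀ j, MaynardDense.mixG (n + 1) (MaynardDense.uOf R (s j) / 2) =
      MaynardDense.prof (n + 1) (u j) + MaynardDense.prof₂ (n + 1) (u j) / (n + 1 : ℕ) := fun j =>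
    MaynardDense.mixG_half hn (hu0' j)
  simp_rw [hmix]
  have hPle : ∏ j, MaynardDense.prof (n + 1) (u j) ≤
      ∏ j, (MaynardDense.prof (n + 1) (u j) + MaynardDense.prof₂ (n + 1) (u j) / (n + 1 : ℕ)) :=
    Finset.prod_le_prod (fun j _ => MaynardDense.prof_nonneg hn (hu0' j)) fun j _ =>
      le_add_of_nonneg_right (div_nonneg (MaynardDense.prof₂_nonneg hn (hu0' j)) hk0.le)
  have hHle := sumH_le_mul_prod_mix hn hu0 (k := n + 1)
  have hQ0 : 0 ≤ ∏ j, (MaynardDense.prof (n + 1) (u j) + MaynardDense.prof₂ (n + 1) (u j) / (n + 1 : ℕ)) :=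
    hP0.trans hPle
  calc MaynardDense.ell₂ (n + 1) * ∏ j, MaynardDense.prof (n + 1) (u j) +
        MaynardDense.ell (n + 1) * MaynardDense.sumH (n + 1) n u
      ≤ MaynardDense.ell₂ (n + 1) *
          ∏ j, (MaynardDense.prof (n + 1) (u j) + MaynardDense.prof₂ (n + 1) (u j) / (n + 1 : ℕ)) +
        MaynardDense.ell (n + 1) * ((n + 1 : ℕ) *
          ∏ j, (MaynardDense.prof (n + 1) (u j) + MaynardDense.prof₂ (n + 1) (u j) / (n + 1 : ℕ))) :=
        add_le_add (mul_le_mul_of_nonneg_left hPle hℓ₂) (mul_le_mul_of_nonneg_left hHle hℓ)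
    _ = _ := by ring

/-! ### The two sums of (9.16)/(9.19) as `(k−1)`-fold sums of Lemma 8.4 -/

/-- **`Σ_{r ∈ 𝒟', r_m=1} (∫F dt_m)²(u(r))/φ_ω(r) = rFoldSum n W' (p ↦ p − ω(p)) (H_ψ²) (g_k²) R 0`** (`k = n + 1 ≥ 2`,
`R > 1`): the sum evaluated «using Lemma 8.4» in (9.19), stripped of the factor `(log R · c_m)²` of Lemma 9.3, is an
instance of (8.9) with `Φ = H_ψ²`, `G = g_k²`, moduli `W'_j`, `g = φ_ω`.
[cite: Maynard2016DenseClusters, proof of Prop. 9.2 (9.19) p. 23, Lemma 8.4 (8.9) p. 16] -/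
theorem sum_margInt_F_sq_eq_rFoldSum (hn : 2 ≤ n + 1) (L : Fin (n + 1) → ℤ × ℤ) (B : ℕ) {R : ℝ}
    (hR : 1 < R) (m : Fin (n + 1)) :
    ∑ r ∈ dkBoxP L B R m, margInt m (MaynardDense.F (n + 1)) (logVec R r) ^ 2 / phiOmega L (∏ i, r i) =
      MaynardDense.rFoldSum n (idxModM L B R m) (fun p => (p : ℝ) - omegaL L p)
        (fun x => MaynardDense.Hpsi (n + 1) x ^ 2) (fun t => MaynardDense.profExt (n + 1) t ^ 2) R 0 := by
  classical
  have hR1 : 1 ≤ ⌊R⌋₊ := Nat.one_le_iff_ne_zero.2 (Nat.pos_iff_ne_zero.1 (Nat.floor_pos.2 hR.le))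
  have hG1 : ∀ t : ℝ, 1 ≤ t → MaynardDense.profExt (n + 1) t ^ 2 = 0 := fun t ht => by
    rw [MaynardDense.profExt_eq_zero_of_one_le hn ht]; ring
  rw [← MaynardDense.sum_piFinset_Icc_eq_rFoldSum n (idxModM L B R m) _ _ hG1 hR 0,
    sum_dkBoxP_eq_sum_insertNth, Finset.sum_filter]
  refine Finset.sum_congr rfl fun s hs => ?_
  rw [rWeight_idxModM_eq hR1 hs]
  split_ifs with hmem
  · have hs1 : ∀ j, 1 ≤ s j := fun j => (Finset.mem_Icc.1 (Fintype.mem_piFinset.1 hs j)).1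
    rw [prod_insertNth_one, margInt_F_insertNth, zero_add, mul_pow, ← Finset.prod_pow]
    have hprof : ∀ j, MaynardDense.prof (n + 1) (MaynardDense.uOf R (s j)) =
        MaynardDense.profExt (n + 1) (MaynardDense.uOf R (s j)) := fun j => by
      rw [MaynardDense.profExt_of_nonneg hn (uOf_nonneg hR (hs1 j))]
    simp_rw [hprof]
    ring
  · rw [zero_mul]

/-- **`Σ_{r ∈ 𝒟', r_m=1} (∫F₂ dt_m)²(u(r))/φ_ω(r) ≤ (∫h_k + k∫g_k)² · rFoldSum n W' (p − ω) 1 (mixG_k²) (R²) 0`**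
(`k = n + 1 ≥ 2`, `R > 1`, admissible `𝓛`): the `F₂`-sum of (9.16)/(9.20) is dominated by an `r`-fold sum (8.9)
at scale `R²` with the one-variable majorant `mixG_k` (`u_j/2 = log s_j/log R²`; the box `[1,⌊R⌋]^n` enlarged to
`[1,⌊R²⌋]^n`, all terms being `≥ 0`).
[cite: Maynard2016DenseClusters, proof of Prop. 9.2 (9.16), (9.20) pp. 22–23, Lemma 8.4 (8.9)] -/
theorem sum_margInt_F₂_sq_le_rFoldSum (hn : 2 ≤ n + 1) {L : Fin (n + 1) → ℤ × ℤ} (hadm : FormsAdmissible L)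
    (B : ℕ) {R : ℝ} (hR : 1 < R) (m : Fin (n + 1)) :
    ∑ r ∈ dkBoxP L B R m, margInt m (MaynardDense.F₂ (n + 1)) (logVec R r) ^ 2 / phiOmega L (∏ i, r i) ≤
      (MaynardDense.ell₂ (n + 1) + (n + 1 : ℕ) * MaynardDense.ell (n + 1)) ^ 2 *
        MaynardDense.rFoldSum n (idxModM L B R m) (fun p => (p : ℝ) - omegaL L p)
          (fun _ => 1) (fun t => MaynardDense.mixG (n + 1) t ^ 2) (R ^ 2) 0 := by
  classical
  have hR1 : 1 ≤ ⌊R⌋₊ := Nat.one_le_iff_ne_zero.2 (Nat.pos_iff_ne_zero.1 (Nat.floor_pos.2 hR.le))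
  have hR2 : 1 < R ^ 2 := by nlinarith
  have hlogR : 0 < Real.log R := Real.log_pos hR
  set cF : ℝ := MaynardDense.ell₂ (n + 1) + (n + 1 : ℕ) * MaynardDense.ell (n + 1) with hcF
  set W' := idxModM L B R m with hW'
  set A : ℕ → ℝ := fun p => (p : ℝ) - omegaL L p with hA
  have hG1 : ∀ t : ℝ, 1 ≤ t → MaynardDense.mixG (n + 1) t ^ 2 = 0 := fun t ht => by
    rw [MaynardDense.mixG_eq_zero hn ht]; ring
  rw [← MaynardDense.sum_piFinset_Icc_eq_rFoldSum n W' A (fun _ => (1 : ℝ)) hG1 hR2 0, Finset.mul_sum,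
    sum_dkBoxP_eq_sum_insertNth]
  -- enlarge the box `[1, ⌊R⌋]^n ∩ {(s;1) ∈ 𝒟'}` to `[1, ⌊R²⌋]^n`
  have hsub : (Fintype.piFinset fun _ : Fin n => Finset.Icc 1 ⌊R⌋₊).filter
      (fun s => Fin.insertNth m 1 s ∈ dkBoxP L B R m) ⊆
      Fintype.piFinset fun _ : Fin n => Finset.Icc 1 ⌊R ^ 2⌋₊ := by
    intro s hs
    have hs' := Fintype.mem_piFinset.1 (Finset.mem_filter.1 hs).1
    rw [Fintype.mem_piFinset]
    intro j
    have h := Finset.mem_Icc.1 (hs' j)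
    exact Finset.mem_Icc.2 ⟨h.1, h.2.trans (Nat.floor_le_floor (by nlinarith))⟩
  have huR : ∀ e : ℕ, MaynardDense.uOf (R ^ 2) e = MaynardDense.uOf R e / 2 := fun e => by
    simp only [MaynardDense.uOf, Real.log_pow]
    push_cast
    field_simp
  have hpt : ∀ s ∈ (Fintype.piFinset fun _ : Fin n => Finset.Icc 1 ⌊R⌋₊).filter
      (fun s => Fin.insertNth m 1 s ∈ dkBoxP L B R m),
      margInt m (MaynardDense.F₂ (n + 1)) (logVec R (Fin.insertNth m 1 s)) ^ 2 /
          phiOmega L (∏ i, (Fin.insertNth m 1 s : Fin (n + 1) → ℕ) i) ≤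
        cF ^ 2 * (MaynardDense.rWeight n W' A s *
          ((fun _ : ℝ => (1 : ℝ)) (0 + ∑ j, MaynardDense.uOf (R ^ 2) (s j)) *
            ∏ j, (fun t => MaynardDense.mixG (n + 1) t ^ 2) (MaynardDense.uOf (R ^ 2) (s j)))) := by
    intro s hs
    obtain ⟨hsb, hmem⟩ := Finset.mem_filter.1 hs
    have hs1 : ∀ j, 1 ≤ s j := fun j => (Finset.mem_Icc.1 (Fintype.mem_piFinset.1 hsb j)).1
    rw [hW', hA, rWeight_idxModM_eq hR1 hsb, if_pos hmem, prod_insertNth_one]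
    simp only [one_mul, huR]
    obtain ⟨h0, hle⟩ := margInt_F₂_insertNth_le hn m hR hs1
    have hφ : 0 < phiOmega L (∏ j, s j) :=
      phiOmega_pos_of_forall_lt L fun p hp =>
        ((formsAdmissible_iff_omegaL L).1 hadm).2 p (Nat.prime_of_mem_primeFactors hp)
    rw [div_eq_mul_inv]
    calc margInt m (MaynardDense.F₂ (n + 1)) (logVec R (Fin.insertNth m 1 s)) ^ 2 * (phiOmega L (∏ j, s j))⁻¹
        ≤ (cF * ∏ j, MaynardDense.mixG (n + 1) (MaynardDense.uOf R (s j) / 2)) ^ 2 *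
            (phiOmega L (∏ j, s j))⁻¹ :=
          mul_le_mul_of_nonneg_right (pow_le_pow_left₀ h0 hle 2) (inv_nonneg.2 hφ.le)
      _ = _ := by rw [mul_pow, Finset.prod_pow]; ring
  have hnn : ∀ s ∈ (Fintype.piFinset fun _ : Fin n => Finset.Icc 1 ⌊R ^ 2⌋₊),
      s ∉ (Fintype.piFinset fun _ : Fin n => Finset.Icc 1 ⌊R⌋₊).filter
        (fun s => Fin.insertNth m 1 s ∈ dkBoxP L B R m) →
      0 ≤ cF ^ 2 * (MaynardDense.rWeight n W' A s *
          ((fun _ : ℝ => (1 : ℝ)) (0 + ∑ j, MaynardDense.uOf (R ^ 2) (s j)) *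
            ∏ j, (fun t => MaynardDense.mixG (n + 1) t ^ 2) (MaynardDense.uOf (R ^ 2) (s j)))) := by
    intro s _ _
    simp only [one_mul]
    exact mul_nonneg (sq_nonneg _) (mul_nonneg (rWeight_idxModM_nonneg hadm B R m s)
      (Finset.prod_nonneg fun j _ => sq_nonneg _))
  exact (Finset.sum_le_sum hpt).trans (Finset.sum_le_sum_of_subset_of_nonneg hsub hnn)

/-! ### The free indices of `W'` at a prime `p`: Lemma 8.4's `n(p)` for the moduli `W'_j` -/

/-- For `p ∣ WB` every `W'_j` is divisible by `p`: `n(p) = 0`.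
[cite: Maynard2016DenseClusters, proof of Prop. 9.2 (9.19) (the products are over p ∤ WB)] -/
theorem nW_idxModM_eq_zero (L : Fin (n + 1) → ℤ × ℤ) {B : ℕ} (R : ℝ) (m : Fin (n + 1)) {p : ℕ}
    (hpW : p ∣ wCut (n + 1) B * B) : MaynardDense.nW n (idxModM L B R m) p = 0 := by
  classical
  unfold MaynardDense.nW
  refine Finset.sum_eq_zero fun j _ => ?_
  rw [if_pos]
  unfold idxModM idxMod
  exact (hpW.mul_right _).mul_right _

/-- For a prime `p ≤ ⌊R⌋`, `p ∤ WB`: `p ∤ W'_j ⟺ (m.succAbove j) ∈ admIdxM L m p`.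
[cite: Maynard2016DenseClusters, proof of Prop. 9.2 p. 21 («p ∣ W'_j/W_j iff p ∤ a_m and j was the chosen index for −b_m a_m⁻¹»)] -/
theorem not_dvd_idxModM_iff {L : Fin (n + 1) → ℤ × ℤ} {B : ℕ} {R : ℝ} {m : Fin (n + 1)} {j : Fin n}
    {p : ℕ} (hp : p.Prime) (hpW : ¬ p ∣ wCut (n + 1) B * B) (hpR : p ≤ ⌊R⌋₊) :
    ¬ p ∣ idxModM L B R m j ↔ m.succAbove j ∈ admIdxM L m p := by
  rw [mem_admIdxM, idxModM, hp.dvd_mul, not_or, prime_dvd_idxMod_iff hp hpW hpR, not_not]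
  constructor
  · rintro ⟨h1, h2⟩; exact ⟨h1, Fin.succAbove_ne m j, h2⟩
  · rintro ⟨h1, -, h2⟩; exact ⟨h1, h2⟩

/-- **`n(p) = #admIdxM(p)`** for a prime `p ≤ ⌊R⌋` with `p ∤ WB` (so `n(p) = ω(p) − 1` if `p ∤ a_m` and
`n(p) = ω(p)` if `p ∣ a_m`, by `card_admIdxM_add`: the Euler factors `(1 + (ω(p)−1)/φ_ω(p))(1 − 1/p)^{k−1}`,
`(1 + ω(p)/φ_ω(p))(1 − 1/p)^{k−1}` of (9.19)).
[cite: Maynard2016DenseClusters, proof of Prop. 9.2 (9.19) p. 23, p. 21 (W'_j)] -/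
theorem nW_idxModM_eq_card_admIdxM {L : Fin (n + 1) → ℤ × ℤ} {B : ℕ} {R : ℝ} (m : Fin (n + 1)) {p : ℕ}
    (hp : p.Prime) (hpW : ¬ p ∣ wCut (n + 1) B * B) (hpR : p ≤ ⌊R⌋₊) :
    MaynardDense.nW n (idxModM L B R m) p = #(admIdxM L m p) := by
  classical
  unfold MaynardDense.nW
  have h : ∀ j : Fin n, (if p ∣ idxModM L B R m j then 0 else 1) =
      (if m.succAbove j ∈ admIdxM L m p then 1 else 0 : ℕ) := fun j => by
    by_cases hj : m.succAbove j ∈ admIdxM L m p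
    · rw [if_pos hj, if_neg ((not_dvd_idxModM_iff hp hpW hpR).2 hj)]
    · rw [if_neg hj, if_pos (not_not.1 fun h => hj ((not_dvd_idxModM_iff hp hpW hpR).1 h))]
  simp_rw [h]
  rw [Finset.sum_boole]
  -- `j ↦ m.succAbove j` is a bijection from `{j : succAbove j ∈ admIdxM}` onto `admIdxM` (as `m ∉ admIdxM`)
  simp only [Nat.cast_id]
  refine Finset.card_nbij (fun j => m.succAbove j) (fun j hj => (Finset.mem_filter.1 hj).2)
    (fun j₁ _ j₂ _ h => Fin.succAbove_right_injective h) fun i hi => ?_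
  have him : i ≠ m := (mem_admIdxM.1 (Finset.mem_coe.1 hi)).2.1
  obtain ⟨j, rfl⟩ := Fin.exists_succAbove_eq him
  exact ⟨j, Finset.mem_coe.2 (Finset.mem_filter.2 ⟨Finset.mem_univ j, Finset.mem_coe.1 hi⟩), rfl⟩

/-- For a prime `p > ⌊R⌋` with `p ∤ WB`: `p ∤ W_j`, so `p ∣ W'_j ⟺ p ∣ a_j b_m − a_m b_j`, and
`n(p) = #{j : p ∤ Δ_{m, succAbove j}}`. [cite: Maynard2016DenseClusters, proof of Prop. 9.2 (9.8) p. 21; Lemma 8.4 (n(p)) p. 16] -/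
theorem nW_idxModM_eq_of_lt (L : Fin (n + 1) → ℤ × ℤ) (B : ℕ) (R : ℝ) (m : Fin (n + 1)) {p : ℕ}
    (hp : p.Prime) (hpW : ¬ p ∣ wCut (n + 1) B * B) (hpR : ⌊R⌋₊ < p) :
    MaynardDense.nW n (idxModM L B R m) p =
      #(Finset.univ.filter fun j : Fin n => ¬ p ∣ (crossDet L m (m.succAbove j)).natAbs) := by
  classical
  unfold MaynardDense.nW
  have h : ∀ j : Fin n, (if p ∣ idxModM L B R m j then 0 else 1) =
      (if ¬ p ∣ (crossDet L m (m.succAbove j)).natAbs then 1 else 0 : ℕ) := fun j => by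
    have hW : ¬ p ∣ idxMod L B R (m.succAbove j) := not_dvd_idxMod_of_lt L B _ hp hpW hpR
    by_cases hΔ : p ∣ (crossDet L m (m.succAbove j)).natAbs
    · rw [if_neg (not_not.2 hΔ), if_pos]
      unfold idxModM; exact hΔ.mul_left _
    · rw [if_pos hΔ, if_neg]
      unfold idxModM; rw [hp.dvd_mul, not_or]; exact ⟨hW, hΔ⟩
  simp_rw [h]
  rw [Finset.sum_boole]
  simp

end Literature.NumberTheory.Sieve.FGKMT2018
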